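import Summits.QuantumFields.YangMills.Theorems.BalabanUVNodesN07ChartTopBoxPlaquettes
import Summits.QuantumFields.YangMills.Theorems.BalabanUVNodesN07ChartTopBoxPlaquetteValuesB
import HarnessLib

/-!
# N07 [B11] (= [15] = [Balaban1985Variational]) Sect. F — MODULE 69a₂ (`…ChartTopBoxPlaquettes`) AT PRINT's [II] (2.3) DATUM AND PRINT's (7) DATA: «(7) FOR V» on a box of good labels from the
# fibre `AgreeOnB (lamBondsSeq Ω k) (Ū U) W` and the data on print's ranges `Sect2.lamPlaqs` ∕ `Sect2.lamPlaqsTop` for print's (7) field `Sect2.mixedFieldB (lamBondsSeq Ω k ·)` (S1c∕C2 of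
# the (E1)∕(iii-b) work plan, director-ym №338∕№339; FLAG №16; LOCATE-HSEAM 5d3298b8d191f169; DOOR-LIST-E1 Tier C2)

Cell `pub-ymgap`, seat `pub-ymgap-dag-n07-e` g34 (FAN-OUT §N07 row s3; LANE OWNER of the K0 road chart side).  `--kind proof --supports stmt-QuantumFields-20541 --as helper` (K0⁷); count-neutral;
def-free.  PRINT-DATUM TWIN of `…N07ChartTopBoxPlaquettes` §4 `dist1_plaqHol_iter_succ_lt_of_touching ∕ _of_not_touching` and §5 `plaqSmallOn_boxPlaqs_iter_succ` (FLAG №16 ∕ LOCATE-HSEAM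
5d3298b8d191f169); the (b)-instances stay landed and true on their own text.  No displayed premise is deleted or weakened except by RE-KEYING to print's objects: the fibre `AgreeOn (genSet Ω k)`
↦ `AgreeOnB (lamBondsSeq Ω k)` ([II] (2.3) «Λ_j = Ω_j^{(j)} ∖ Ω_{j+1}^{(j)} … for the sets of sites and the sets of bonds», p. 224; ruling (α): the DIFFERENCE of the bond sets — inward connectors
belong to no `Λ_j`), the data ranges `Sect2.printedPlaqs ∕ printedPlaqsTop` ↦ §7′'s `Sect2.lamPlaqs ∕ lamPlaqsTop` with the (7) field `Sect2.mixedField (genSet …)` ↦ `Sect2.mixedFieldB (lamBondsSeq …)`;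
the price is DISPLAYED — block saturation of `Ω_{m+2}` below the top (to read «off `Ω_{m+2}`» in F0a's block spelling) next to 69a₂'s saturation of `Ω_{m+1}`.  SAME CONSTANT `C_L`, same guards.
[15] = [Balaban1985Variational]; [3] = [Balaban1985Averaging]; [II] = [Balaban1984PropagatorsII]; [III] = [Balaban1988Convergent]; [I] = [Balaban1987RG1].

WHY (DOOR-LIST-E1 Tier C2).  69a₂ is THE data reader of the chart road: every near-row supplier (`…PrintWindowDataSmall`, `…DentBlockDataSmall`, `…DentPairDataSmall`, hence 98′∕99′) reads the
data through it.  Its two cases survive the re-keying verbatim because the chart box of a print-margin-clean datum has NO deep vertex: (touching) a plaquette with a vertex in `Γ_{m+1}` and all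
vertices off `Ω_{m+2}` is a print (7) plaquette of `Sect2.lamPlaqs Ω k (m+1)` and, by 69a₁ᴮ, `M^{m+1}U(∂p′)` IS print's (7) plaquette variable; (non-touching) all four labels are second-kind
vertices (off `Ω_{m+1}^{(m+1)}`, everything below in `Γ_m`), so every level-`m` plaquette under them has its four bonds in `Λ_m` (fibre: `M^m U = W_m` there) and its four corners in `Γ_m` — a
print (7) plaquette of level `m` (`Sect2.lamPlaqs Ω k m`; for `m = 0` of `Sect2.lamPlaqsTop`) — and MODULE 68's tight-hull Prop. 1 applies as before.

WHAT IS PROVED (sorry-free; no definition; axioms standard).  §1 ★★★ `dist1_plaqHol_iter_succ_lt_of_touchingB`, ★★★ `dist1_plaqHol_iter_succ_lt_of_not_touchingB` (69a₂ §4 over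
`AgreeOnB (lamBondsSeq Ω k)` and print's ranges).  §2 ★★★ `plaqSmallOn_boxPlaqs_iter_succB` — «(7) FOR V» on an integer box of good labels: `PlaqSmallOn (boxPlaqs tlo thi) (δ₁ + C_L·a) (M^{m+1} U)`
from the (2.3) fibre, print's level-`(m+1)` clause at `δ₁`, print's level-`m` clause at `a` (top-domain clause for `m = 0`), saturation of `Ω_{m+1}` (and of `Ω_{m+2}` below the top), margin ∕
collar ∕ support — 69a₂ §5's statement re-keyed, proof re-threaded through §1 and 69a₁ᴮ.
HONEST SCOPE.  Elementary bookkeeping on the fibre + MODULE 68 by name; nothing of [15]'s analysis asserted; K0⁷ ∕ K1⁹ NOT closed; N07 NOT discharged; counts unmoved (typed 28∕28 · discharged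
8∕28); one finite 𝕋⁴ programme at fixed ε — the route closes the conditional finite-𝕋⁴ rung `BalabanLadder.UV` ONLY; the YM mass gap (Clay) is NOT proved by any of this; nothing continuum ∕
ℝ⁴ ∕ OS.  No `sorry`, no `def`, no `instance`, no `notation`.

References: [15] (7) p. 278 L20–33, (13) p. 280, (144) p. 300, (147) p. 301, (160) p. 303; [3] Prop. 1 (51) pp. 25–26; [II] (2.3) p. 224 L10–16; [III] p. 255, (2.2) p. 255, (2.10)–(2.11)
p. 256; [I] (0.1)–(0.4) pp. 251–253.
-/

set_option autoImplicit false

noncomputable section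
open scoped BigOperators Matrix.Norms.L2Operator

namespace Summit.QuantumFields.YangMills.BalabanUVNodes.N07ChartTopBoxPlaquettesB

open Literature.MathematicalPhysics.QuantumFieldTheory.Balaban1983to89
open Literature.MathematicalPhysics.QuantumFieldTheory.Balaban1983to89.Node00
open Literature.MathematicalPhysics.QuantumFieldTheory.Balaban1983to89.B15DeterminingSets
open Literature.MathematicalPhysics.QuantumFieldTheory.Balaban1983to89.B15DeterminingSetsB
open T4Continuum (T4Family)
open T4AxialGaugeSmallField (castSite castSite_apply castSite_add_e boxPlaqs)
open B15Eq112TorusCover (cover)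
open B14DomainGeom (Pt)
open B7Prop1Explicit (e e_apply)
open B8Eq131Cubes (box bLo bHi)
open B5Eq118OneStroke (iterBlockOf iterBlockOf_succ)
open GaugeField (plaqHol)
open ExpMeanLog (deltaSU)
open BlockAveraging (blockAvg_avg)
open B8Eq17ClassAkV1 (plaqsOf mem_plaqsOf)
open Summit.QuantumFields.YangMills.BalabanUVNodes.N07DataDownTheTowerBlowDown (blockOf_mem_box_of_mem_blowDown ediv_mem_Icc_of_mem_blowDown)
open Summit.QuantumFields.YangMills.BalabanUVNodes.N07AveragedPlaquetteCornerBlocks (dist1_plaqHol_avOfRecord_lt_of_cornerBlocks)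
open Summit.QuantumFields.YangMills.BalabanUVNodes.N07ChartTopBoxPlaquetteValues (embIter_castSite_mem_unitBox mem_Icc_two_of_mem_Icc)
open Summit.QuantumFields.YangMills.BalabanUVNodes.N07ChartTopBoxPlaquetteValuesB (corner_dichotomyB mem_lamBondsSeq_of_below plaqHol_iter_succ_eq_mixedFieldB)

/-! ## §1  The two cases over the (2.3) fibre and print's ranges -/

section Cases

variable (F : T4Family) (N : ℕ) [NeZero N] (K : ℕ) {m k : ℕ} (Ω : ℕ → Set (Site (F.P K) 0)) (W : MSField (F.P K) (SU N)) (U : GaugeField (F.P K) 0 (SU N))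

/-- ★★★ **A TOUCHING CHART-BOX PLAQUETTE IS A PRINT (7) PLAQUETTE, HENCE `δ`-SMALL** (print datum): all four vertices good (second kind carries «off `Ω_{m+1}^{(m+1)}`») and off `Ω_{m+2}`
(both spellings), one of them in `Γ_{m+1}` ⇒ `|M^{m+1}U(∂p′) − 1| < δ` from print's level-`(m+1)` clause `PlaqSmallOn (Sect2.lamPlaqs Ω k (m+1)) δ (Sect2.mixedFieldB … (lamBondsSeq Ω k (m+1)) …)`.
[cite: Balaban1985Variational, (7) p.278 L20–33, (160) p.303; Balaban1984PropagatorsII, (2.3) p.224] -/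
theorem dist1_plaqHol_iter_succ_lt_of_touchingB (hm : m + 1 ≤ (F.P K).m + (F.P K).K) (hfib : AgreeOnB (lamBondsSeq Ω k) (avgFamily (avOfRecord F N K) U) W)
    {δ : ℝ} (h7 : PlaqSmallOn (Sect2.lamPlaqs Ω k (m + 1)) δ (Sect2.mixedFieldB (avOfRecord F N K) (lamBondsSeq Ω k (m + 1)) (W (m + 1)) (W m)))
    (p : Plaq (F.P K) (m + 1))
    (hgood : ∀ y : Site (F.P K) (m + 1), (y = p.src ∨ y = p.src.shift p.μ ∨ y = p.src.shift p.ν ∨ y = (p.src.shift p.μ).shift p.ν) →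
      (y ∈ genSet Ω k (m + 1) ∨ (y ∉ pts (m + 1) (Ω (m + 1)) ∧ ∀ y' : Site (F.P K) m, blockOf y' = y → y' ∈ genSet Ω k m)))
    (hoff : ∀ y : Site (F.P K) (m + 1), (y = p.src ∨ y = p.src.shift p.μ ∨ y = p.src.shift p.ν ∨ y = (p.src.shift p.μ).shift p.ν) →
      y ∉ pts (m + 1) (Ω (m + 1 + 1)))
    (hoffB : m + 1 < k → ∀ y : Site (F.P K) (m + 1), (y = p.src ∨ y = p.src.shift p.μ ∨ y = p.src.shift p.ν ∨ y = (p.src.shift p.μ).shift p.ν) →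
      blockOf y ∉ pts (m + 1 + 1) (Ω (m + 1 + 1)))
    (htouch : p ∈ plaqsOf (genSet Ω k (m + 1))) :
    dist1 (plaqHol (Averaging.iter (avOfRecord F N K) (m + 1) U) p) < δ := by
  rw [plaqHol_iter_succ_eq_mixedFieldB F N K Ω W U hm hfib p hgood hoffB]
  exact h7 p ⟨htouch, fun _ => ⟨hoff _ (Or.inl rfl), hoff _ (Or.inr (Or.inl rfl)), hoff _ (Or.inr (Or.inr (Or.inl rfl))), hoff _ (Or.inr (Or.inr (Or.inr rfl)))⟩⟩

/-- ★★★ **A NON-TOUCHING CHART-BOX PLAQUETTE IS ONCE-AVERAGED LEVEL-`m` DATA, HENCE `C_L·δ`-SMALL** (print datum): if every label of `[x, x + e_μ + e_ν]` is a second-kind vertex (off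
`Ω_{m+1}^{(m+1)}`, everything below in `Γ_m`), then every level-`m` plaquette based in the four corner blocks has its four corners in `Γ_m` and its four bonds in `Λ_m` — a print (7) plaquette of
`Sect2.lamPlaqs Ω k m` on which the (7) field IS `W_m = M^m U` — and MODULE 68's tight-hull Prop. 1 applies: for `m ≥ 1` from print's level-`m` clause, for `m = 0` from the top-domain clause on
`Sect2.lamPlaqsTop Ω Ω₀ k`.  Guards: MODULE 68's. [cite: Balaban1985Variational, (7) p.278, (13) p.280, (160) p.303; Balaban1985Averaging, Prop. 1 (51) pp.25–26; Balaban1984PropagatorsII, (2.3) p.224] -/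
theorem dist1_plaqHol_iter_succ_lt_of_not_touchingB (hmk : m + 1 ≤ k) (hm : m + 1 ≤ (F.P K).m + (F.P K).K)
    (hfib : AgreeOnB (lamBondsSeq Ω k) (avgFamily (avOfRecord F N K) U) W)
    {a : ℝ} (ha : 0 < a) (hN : 2 * (F.P K).L < (F.P K).sitesPerDir m)
    (ht : (((((F.P K).d + 2) * (F.P K).L : ℕ) : ℝ) ^ 2 / 4) * ((4 * (((((F.P K).d - 1 : ℕ) : ℝ)) * ((2 * (F.P K).L - 1 : ℕ) : ℝ)) + 1) * a) < deltaSU (Fin N))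
    (h7m : 1 ≤ m → ∀ q : Plaq (F.P K) m, q ∈ Sect2.lamPlaqs Ω k m → (∀ c : PBond (F.P K) m,
        (c = ⟨q.src, q.μ⟩ ∨ c = ⟨q.src.shift q.μ, q.ν⟩ ∨ c = ⟨q.src.shift q.ν, q.μ⟩ ∨ c = ⟨q.src, q.ν⟩) → c ∈ lamBondsSeq Ω k m) → dist1 (plaqHol (W m) q) < a)
    {Ω₀ : Set (Site (F.P K) 0)} (h70 : m = 0 → PlaqSmallOn (Sect2.lamPlaqsTop Ω Ω₀ k) a (W 0))
    (x : Pt (F.P K).d) {μ ν : Fin (F.P K).d} (hμν : μ < ν)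
    (hgood2 : ∀ t ∈ Set.Icc x (x + e μ + e ν), (castSite t : Site (F.P K) (m + 1)) ∉ pts (m + 1) (Ω (m + 1)) ∧
      ∀ y' : Site (F.P K) m, blockOf y' = (castSite t : Site (F.P K) (m + 1)) → y' ∈ genSet Ω k m)
    (hsupp : m = 0 → ∀ t ∈ Set.Icc x (x + e μ + e ν), ∀ z ∈ box (F.P K).L t 1 (m + 1), cover (F.P K) z ∈ Ω₀) :
    dist1 (plaqHol (Averaging.iter (avOfRecord F N K) (m + 1) U) ⟨castSite x, μ, ν, hμν⟩) <
      (((F.P K).L : ℝ) ^ 2 + 6 * ((((F.P K).d + 2) * (F.P K).L : ℕ) : ℝ) ^ 2) * ((4 * (((((F.P K).d - 1 : ℕ) : ℝ)) * ((2 * (F.P K).L - 1 : ℕ) : ℝ)) + 1) * a) := by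
  -- `M^{m+1} U = M(M^m U)`; MODULE 68 at `V = M^m U`
  show dist1 (plaqHol ((avOfRecord F N K m).avg (Averaging.iter (avOfRecord F N K) m U)) ⟨castSite x, μ, ν, hμν⟩) < _
  refine dist1_plaqHol_avOfRecord_lt_of_cornerBlocks F N K hm ha hN ht _ x hμν fun q hq => ?_
  -- a level-`m` plaquette based in the blow-down box: all four vertices lie below labels of `[x, x + e_μ + e_ν]`, hence in `Γ_m`, with blocks off `Ω_{m+1}^{(m+1)}`
  obtain ⟨w, hwlo, hwhi, hwsrc⟩ := hq
  have heμ : ∀ κ i : Fin (F.P K).d, (0 : ℤ) ≤ e κ i ∧ e κ i ≤ 1 := fun κ i => by rw [e_apply]; split_ifs <;> norm_num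
  have hvert : ∀ w' : Pt (F.P K).d, (w' = w ∨ w' = w + e q.μ ∨ w' = w + e q.ν ∨ w' = w + e q.μ + e q.ν) →
      (castSite w' : Site (F.P K) m) ∈ genSet Ω k m ∧ blockOf (castSite w' : Site (F.P K) m) ∉ pts (m + 1) (Ω (m + 1)) := by
    intro w' hw'
    have hw'box : w' ∈ Set.Icc (fun i => ((F.P K).L : ℤ) * x i) (fun i => ((F.P K).L : ℤ) * (x + e μ + e ν) i + (((F.P K).L : ℤ) - 1)) := by
      constructor <;> intro i
      · have := hwlo i
        rcases hw' with rfl | rfl | rfl | rfl <;> simp only [Pi.add_apply] <;> linarith [(heμ q.μ i).1, (heμ q.ν i).1]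
      · have := hwhi i
        simp only [Pi.add_apply] at this
        rcases hw' with rfl | rfl | rfl | rfl <;> simp only [Pi.add_apply] <;> linarith [(heμ q.μ i).1, (heμ q.ν i).1]
    obtain ⟨t, htI, htb⟩ := blockOf_mem_box_of_mem_blowDown hm (⟨w', hw'box, rfl⟩ :
      (castSite w' : Site (F.P K) m) ∈ (castSite '' Set.Icc (fun i => ((F.P K).L : ℤ) * x i) (fun i => ((F.P K).L : ℤ) * (x + e μ + e ν) i + (((F.P K).L : ℤ) - 1)) : Set (Site (F.P K) m)))
    exact ⟨(hgood2 t htI).2 (castSite w') htb.symm, by rw [← htb]; exact (hgood2 t htI).1⟩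
  have h1 := hvert w (Or.inl rfl)
  have h2 : (castSite w : Site (F.P K) m).shift q.μ ∈ genSet Ω k m ∧ blockOf ((castSite w : Site (F.P K) m).shift q.μ) ∉ pts (m + 1) (Ω (m + 1)) := by
    rw [← castSite_add_e]; exact hvert _ (Or.inr (Or.inl rfl))
  have h3 : (castSite w : Site (F.P K) m).shift q.ν ∈ genSet Ω k m ∧ blockOf ((castSite w : Site (F.P K) m).shift q.ν) ∉ pts (m + 1) (Ω (m + 1)) := by
    rw [← castSite_add_e]; exact hvert _ (Or.inr (Or.inr (Or.inl rfl)))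
  have h4 : ((castSite w : Site (F.P K) m).shift q.μ).shift q.ν ∈ genSet Ω k m ∧ blockOf (((castSite w : Site (F.P K) m).shift q.μ).shift q.ν) ∉ pts (m + 1) (Ω (m + 1)) := by
    rw [← castSite_add_e, ← castSite_add_e]; exact hvert _ (Or.inr (Or.inr (Or.inr rfl)))
  have hcomm : ((castSite w : Site (F.P K) m).shift q.ν).shift q.μ = ((castSite w : Site (F.P K) m).shift q.μ).shift q.ν := by
    have hne : q.μ ≠ q.ν := q.hμν.ne
    simp only [Site.shift, Function.update_of_ne hne, Function.update_of_ne hne.symm]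
    exact (Function.update_comm hne _ _ _).symm
  have h4' : ((castSite w : Site (F.P K) m).shift q.ν).shift q.μ ∈ genSet Ω k m ∧ blockOf (((castSite w : Site (F.P K) m).shift q.ν).shift q.μ) ∉ pts (m + 1) (Ω (m + 1)) := by
    rw [hcomm]; exact h4
  -- all four bonds of `q` are `Λ_m`-bonds: the fibre gives `M^m U = W_m` on them
  have hbonds : ∀ c : PBond (F.P K) m, (c = ⟨q.src, q.μ⟩ ∨ c = ⟨q.src.shift q.μ, q.ν⟩ ∨ c = ⟨q.src.shift q.ν, q.μ⟩ ∨ c = ⟨q.src, q.ν⟩) →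
      c ∈ lamBondsSeq Ω k m := by
    intro c hc
    rw [hwsrc] at hc
    rcases hc with rfl | rfl | rfl | rfl
    · exact ⟨Or.inl h1.1, fun _ => ⟨h1.2, h2.2⟩⟩
    · exact ⟨Or.inl h2.1, fun _ => ⟨h2.2, h4.2⟩⟩
    · exact ⟨Or.inl h3.1, fun _ => ⟨h3.2, h4'.2⟩⟩
    · exact ⟨Or.inl h1.1, fun _ => ⟨h1.2, h3.2⟩⟩
  have hf : ∀ c : PBond (F.P K) m, c ∈ lamBondsSeq Ω k m → Averaging.iter (avOfRecord F N K) m U c = W m c := fun c hc => hfib m c hc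
  have hplaq : plaqHol (Averaging.iter (avOfRecord F N K) m U) q = plaqHol (W m) q := by
    unfold GaugeField.plaqHol
    rw [hf _ (hbonds _ (Or.inl rfl)), hf _ (hbonds _ (Or.inr (Or.inl rfl))), hf _ (hbonds _ (Or.inr (Or.inr (Or.inl rfl)))),
      hf _ (hbonds _ (Or.inr (Or.inr (Or.inr rfl))))]
  rw [hplaq]
  -- `Γ_m` misses `Ω_{m+1}`: the four corners of `q` are off `Ω_{m+1}^{(m)}` — a print (7) plaquette of level `m`
  have hΓ : ∀ y : Site (F.P K) m, y ∈ genSet Ω k m → y ∉ pts m (Ω (m + 1)) := by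
    intro y hy habs
    have hy' : embIter m y ∈ gammaRegion Ω k m := (mem_pts.1 hy)
    rw [mem_pts] at habs
    rcases Nat.eq_zero_or_pos m with h0 | h0
    · subst h0; rw [gammaRegion_zero Ω (by omega)] at hy'; exact hy' habs
    · rw [gammaRegion_mid Ω h0 (by omega)] at hy'; exact hy'.2 habs
  have hlam : q ∈ Sect2.lamPlaqs Ω k m := by
    refine ⟨?_, fun _ => ⟨?_, ?_, ?_, ?_⟩⟩
    · rw [mem_plaqsOf, hwsrc]; exact Or.inl h1.1
    · rw [hwsrc]; exact hΓ _ h1.1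
    · rw [hwsrc]; exact hΓ _ h2.1
    · rw [hwsrc]; exact hΓ _ h3.1
    · rw [hwsrc]; exact hΓ _ h4.1
  rcases Nat.eq_zero_or_pos m with h0 | h0
  · -- level `0`: the top-domain clause; the plaquette meets `Ω₀` at its lower corner
    subst h0
    refine h70 rfl q ⟨hlam, ?_⟩
    rw [mem_plaqsOf, hwsrc]
    left
    have hwbox : w ∈ Set.Icc (fun i => ((F.P K).L : ℤ) * x i) (fun i => ((F.P K).L : ℤ) * (x + e μ + e ν) i + (((F.P K).L : ℤ) - 1)) :=
      ⟨hwlo, fun i => by have := hwhi i; simp only [Pi.add_apply] at this ⊢; linarith [(heμ q.μ i).1, (heμ q.ν i).1]⟩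
    have htI := ediv_mem_Icc_of_mem_blowDown (F.P K).L_pos hwbox
    have hunit : w ∈ box (F.P K).L (fun i => w i / ((F.P K).L : ℤ)) 1 (0 + 1) := by
      intro i
      simp only [bLo, bHi, Nat.cast_zero, sub_zero, add_zero, Nat.cast_one, zero_add, pow_one]
      have hL0 : (0 : ℤ) < (F.P K).L := by exact_mod_cast (F.P K).L_pos
      constructor
      · have := Int.ediv_mul_le (w i) hL0.ne'; linarith
      · have := Int.lt_ediv_add_one_mul_self (w i) hL0; linarith
    exact hsupp rfl _ htI w hunit
  · exact h7m h0 q hlam hbonds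

end Cases

/-! ## §2  All plaquettes of an integer box of good labels, at print's datum -/

section All

variable (F : T4Family) (N : ℕ) [NeZero N] (K : ℕ) {m k : ℕ} (Ω : ℕ → Set (Site (F.P K) 0)) (W : MSField (F.P K) (SU N)) (U : GaugeField (F.P K) 0 (SU N))

/-- ★★★ **«(7) FOR V» ON A BOX OF GOOD LABELS, AT PRINT's DATUM**: on the (2.3) fibre `M˙(U)|_Λ = W` with print's level-`(m+1)` clause at `δ₁` and level-`m` clause at `a` (top-domain clause for
`m = 0`), block saturation of `Ω_{m+1}` (and of `Ω_{m+2}` below the top), and an integer box `[tlo, thi]` of level-`(m+1)` labels whose unit boxes (margin) carry no point of `Ω_{m+2}`, (collar,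
`m ≥ 1`) project into `Ω_m`, (support, `m = 0`) project into `Ω₀`: EVERY level-`(m+1)` plaquette of `M^{m+1} U` based in the box is `< δ₁ + C_L·a`, `C_L = (L² + 6((d+2)L)²)·(4(d−1)(2L−1) + 1)`.
Guards: `0 ≤ δ₁`, `0 < a`, `2L < N_m`, MODULE 68's `δ_N`-guard. [cite: Balaban1985Variational, (7) p.278 L20–33, (13) p.280, (147) p.301, (160) p.303; Balaban1985Averaging, Prop. 1 (51) pp.25–26; Balaban1984PropagatorsII, (2.3) p.224; Balaban1988Convergent, p.255, (2.2), (2.10) pp.255–256] -/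
theorem plaqSmallOn_boxPlaqs_iter_succB (hmk : m + 1 ≤ k) (hm : m + 1 ≤ (F.P K).m + (F.P K).K)
    (hfib : AgreeOnB (lamBondsSeq Ω k) (avgFamily (avOfRecord F N K) U) W)
    (hsat : ∀ x x' : Site (F.P K) 0, iterBlockOf (m + 1) x = iterBlockOf (m + 1) x' → x ∈ Ω (m + 1) → x' ∈ Ω (m + 1))
    (hm2 : m + 1 < k → m + 1 + 1 ≤ (F.P K).m + (F.P K).K)
    (hsat2 : m + 1 < k → ∀ x x' : Site (F.P K) 0, iterBlockOf (m + 1 + 1) x = iterBlockOf (m + 1 + 1) x' → x ∈ Ω (m + 1 + 1) → x' ∈ Ω (m + 1 + 1))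
    {δ₁ a : ℝ} (hδ₁ : 0 ≤ δ₁) (ha : 0 < a) (hN : 2 * (F.P K).L < (F.P K).sitesPerDir m)
    (ht : (((((F.P K).d + 2) * (F.P K).L : ℕ) : ℝ) ^ 2 / 4) * ((4 * (((((F.P K).d - 1 : ℕ) : ℝ)) * ((2 * (F.P K).L - 1 : ℕ) : ℝ)) + 1) * a) < deltaSU (Fin N))
    (h7succ : PlaqSmallOn (Sect2.lamPlaqs Ω k (m + 1)) δ₁ (Sect2.mixedFieldB (avOfRecord F N K) (lamBondsSeq Ω k (m + 1)) (W (m + 1)) (W m)))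
    (h7m : ∀ m', m' + 1 = m → PlaqSmallOn (Sect2.lamPlaqs Ω k (m' + 1)) a (Sect2.mixedFieldB (avOfRecord F N K) (lamBondsSeq Ω k (m' + 1)) (W (m' + 1)) (W m')))
    {Ω₀ : Set (Site (F.P K) 0)} (h70 : m = 0 → PlaqSmallOn (Sect2.lamPlaqsTop Ω Ω₀ k) a (W 0))
    {tlo thi : Pt (F.P K).d}
    (hfar : ∀ t ∈ Set.Icc tlo thi, ∀ z ∈ box (F.P K).L t 1 (m + 1), cover (F.P K) z ∉ Ω (m + 2))
    (hcol : 1 ≤ m → ∀ t ∈ Set.Icc tlo thi, ∀ z ∈ box (F.P K).L t 1 (m + 1), cover (F.P K) z ∈ Ω m)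
    (hsupp : m = 0 → ∀ t ∈ Set.Icc tlo thi, ∀ z ∈ box (F.P K).L t 1 (m + 1), cover (F.P K) z ∈ Ω₀) :
    PlaqSmallOn (boxPlaqs tlo thi) (δ₁ + (((F.P K).L : ℝ) ^ 2 + 6 * ((((F.P K).d + 2) * (F.P K).L : ℕ) : ℝ) ^ 2) *
      ((4 * (((((F.P K).d - 1 : ℕ) : ℝ)) * ((2 * (F.P K).L - 1 : ℕ) : ℝ)) + 1) * a)) (Averaging.iter (avOfRecord F N K) (m + 1) U) := by
  intro p hp
  obtain ⟨x, hxlo, hxhi, hsrc⟩ := hp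
  have hC : 0 ≤ (((F.P K).L : ℝ) ^ 2 + 6 * ((((F.P K).d + 2) * (F.P K).L : ℕ) : ℝ) ^ 2) *
      ((4 * (((((F.P K).d - 1 : ℕ) : ℝ)) * ((2 * (F.P K).L - 1 : ℕ) : ℝ)) + 1) * a) := by positivity
  have heμ : ∀ κ i : Fin (F.P K).d, (0 : ℤ) ≤ e κ i := fun κ i => by rw [e_apply]; split_ifs <;> norm_num
  -- every label of `[x, x + e_μ + e_ν]` is in `[tlo, thi]`, hence good
  have hlab : ∀ t ∈ Set.Icc x (x + e p.μ + e p.ν), t ∈ Set.Icc tlo thi := fun t ht =>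
    ⟨fun i => le_trans (hxlo i) (ht.1 i), fun i => le_trans (ht.2 i) (hxhi i)⟩
  have hdich : ∀ t ∈ Set.Icc x (x + e p.μ + e p.ν),
      (castSite t : Site (F.P K) (m + 1)) ∈ genSet Ω k (m + 1) ∨
        ((castSite t : Site (F.P K) (m + 1)) ∉ pts (m + 1) (Ω (m + 1)) ∧ ∀ y : Site (F.P K) m, blockOf y = (castSite t : Site (F.P K) (m + 1)) → y ∈ genSet Ω k m) :=
    fun t htI => corner_dichotomyB Ω hmk hm hsat (hfar t (hlab t htI)) (fun h1 => hcol h1 t (hlab t htI))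
  -- the four vertices as labels
  have hxI : x ∈ Set.Icc x (x + e p.μ + e p.ν) := ⟨le_rfl, fun i => by simp only [Pi.add_apply]; linarith [heμ p.μ i, heμ p.ν i]⟩
  have hxμI : x + e p.μ ∈ Set.Icc x (x + e p.μ + e p.ν) :=
    ⟨fun i => by simp only [Pi.add_apply]; linarith [heμ p.μ i], fun i => by simp only [Pi.add_apply]; linarith [heμ p.ν i]⟩
  have hxνI : x + e p.ν ∈ Set.Icc x (x + e p.μ + e p.ν) :=
    ⟨fun i => by simp only [Pi.add_apply]; linarith [heμ p.ν i], fun i => by simp only [Pi.add_apply]; linarith [heμ p.μ i]⟩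
  have hxμνI : x + e p.μ + e p.ν ∈ Set.Icc x (x + e p.μ + e p.ν) := ⟨fun i => by simp only [Pi.add_apply]; linarith [heμ p.μ i, heμ p.ν i], le_rfl⟩
  have hverts : ∀ y : Site (F.P K) (m + 1), (y = p.src ∨ y = p.src.shift p.μ ∨ y = p.src.shift p.ν ∨ y = (p.src.shift p.μ).shift p.ν) →
      ∃ t ∈ Set.Icc x (x + e p.μ + e p.ν), y = castSite t := by
    intro y hy
    rcases hy with rfl | rfl | rfl | rfl
    · exact ⟨x, hxI, hsrc⟩
    · exact ⟨x + e p.μ, hxμI, by rw [hsrc, castSite_add_e]⟩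
    · exact ⟨x + e p.ν, hxνI, by rw [hsrc, castSite_add_e]⟩
    · exact ⟨x + e p.μ + e p.ν, hxμνI, by rw [hsrc, castSite_add_e, castSite_add_e]⟩
  have hgood : ∀ y : Site (F.P K) (m + 1), (y = p.src ∨ y = p.src.shift p.μ ∨ y = p.src.shift p.ν ∨ y = (p.src.shift p.μ).shift p.ν) →
      (y ∈ genSet Ω k (m + 1) ∨ (y ∉ pts (m + 1) (Ω (m + 1)) ∧ ∀ y' : Site (F.P K) m, blockOf y' = y → y' ∈ genSet Ω k m)) := by
    intro y hy
    obtain ⟨t, htI, rfl⟩ := hverts y hy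
    exact hdich t htI
  -- no vertex lies in `Ω_{m+2}^{(m+1)}` (margin at the vertex's own centre) — in both spellings (block spelling below the top, by saturation of `Ω_{m+2}`)
  have hoff : ∀ y : Site (F.P K) (m + 1), (y = p.src ∨ y = p.src.shift p.μ ∨ y = p.src.shift p.ν ∨ y = (p.src.shift p.μ).shift p.ν) →
      y ∉ pts (m + 1) (Ω (m + 1 + 1)) := by
    intro y hy habs
    obtain ⟨t, htI, rfl⟩ := hverts y hy
    obtain ⟨xc, hxc, hce⟩ := embIter_castSite_mem_unitBox hm t
    rw [mem_pts, hce] at habs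
    exact hfar t (hlab t htI) xc hxc habs
  have hoffB : m + 1 < k → ∀ y : Site (F.P K) (m + 1), (y = p.src ∨ y = p.src.shift p.μ ∨ y = p.src.shift p.ν ∨ y = (p.src.shift p.μ).shift p.ν) →
      blockOf y ∉ pts (m + 1 + 1) (Ω (m + 1 + 1)) :=
    fun hlt y hy habs => hoff y hy ((mem_pts_iff_blockOf_mem_pts_of_saturated (hm2 hlt) (hsat2 hlt) y).2 habs)
  by_cases htouch : p ∈ plaqsOf (genSet Ω k (m + 1))
  · -- touching: a print (7) plaquette
    have h := dist1_plaqHol_iter_succ_lt_of_touchingB F N K Ω W U hm hfib h7succ p hgood hoff hoffB htouch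
    linarith
  · -- non-touching: once-averaged level-`m` data on the four corner blocks
    have hgood2 : ∀ t ∈ Set.Icc x (x + e p.μ + e p.ν), (castSite t : Site (F.P K) (m + 1)) ∉ pts (m + 1) (Ω (m + 1)) ∧
        ∀ y' : Site (F.P K) m, blockOf y' = (castSite t : Site (F.P K) (m + 1)) → y' ∈ genSet Ω k m := by
      intro t htI
      rcases hdich t htI with h | h
      · -- this label IS a vertex of `p′`: contradiction with non-touching
        exfalso
        apply htouch
        rw [mem_plaqsOf, hsrc]
        rcases mem_Icc_two_of_mem_Icc p.hμν.ne htI with rfl | rfl | rfl | rfl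
        · exact Or.inl h
        · exact Or.inr (Or.inl (by rw [← castSite_add_e]; exact h))
        · exact Or.inr (Or.inr (Or.inl (by rw [← castSite_add_e]; exact h)))
        · exact Or.inr (Or.inr (Or.inr (by rw [← castSite_add_e, ← castSite_add_e]; exact h)))
      · exact h
    have h7m' : 1 ≤ m → ∀ q : Plaq (F.P K) m, q ∈ Sect2.lamPlaqs Ω k m → (∀ c : PBond (F.P K) m,
        (c = ⟨q.src, q.μ⟩ ∨ c = ⟨q.src.shift q.μ, q.ν⟩ ∨ c = ⟨q.src.shift q.ν, q.μ⟩ ∨ c = ⟨q.src, q.ν⟩) → c ∈ lamBondsSeq Ω k m) → dist1 (plaqHol (W m) q) < a := by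
      intro h1 q hq hb
      obtain ⟨m', rfl⟩ : ∃ m', m = m' + 1 := ⟨m - 1, by omega⟩
      have h7 := h7m m' rfl q hq
      have heq : plaqHol (Sect2.mixedFieldB (avOfRecord F N K) (lamBondsSeq Ω k (m' + 1)) (W (m' + 1)) (W m')) q = plaqHol (W (m' + 1)) q := by
        unfold GaugeField.plaqHol
        rw [Sect2.mixedFieldB_of_mem _ _ _ (hb _ (Or.inl rfl)), Sect2.mixedFieldB_of_mem _ _ _ (hb _ (Or.inr (Or.inl rfl))),
          Sect2.mixedFieldB_of_mem _ _ _ (hb _ (Or.inr (Or.inr (Or.inl rfl)))), Sect2.mixedFieldB_of_mem _ _ _ (hb _ (Or.inr (Or.inr (Or.inr rfl))))]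
      rwa [heq] at h7
    obtain ⟨src, μ, ν, hμν⟩ := p
    simp only at hsrc
    subst hsrc
    have h := dist1_plaqHol_iter_succ_lt_of_not_touchingB F N K Ω W U hmk hm hfib ha hN ht h7m' h70 x hμν hgood2
      (fun h0 t htI z hz => hsupp h0 t (hlab t htI) z hz)
    linarith

end All

end Summit.QuantumFields.YangMills.BalabanUVNodes.N07ChartTopBoxPlaquettesB

end
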